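import Literature.NumberTheory.Automorphic.ArchChartOrbHaarScaling         -- ★ LH3-p03 (g3): `chartOrbG_smul_measure`, `chartOrbG_eq_haarScalarFactor_mul`, `isHaarMeasure_prodConventionG`, `isMulRightInvariant_prodConventionG`
import Literature.NumberTheory.Rogawski1990.ArchBouazizClassMultiplierG    -- ★ p852007 (this seat): `chartOrbG_classMul`, `orbFamG_classMul`, `orbFamGExt_classMul_of_mem_regG`, `stableSumG_orbFamGExt_classMul_eq_ite`, `ArchSmooth.classMul`; brings ★ `orbFamGExt`, ★ `stableSumG`, `slotPerm_mem_regG_iff`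
import HarnessLib

/-!
# HAAR RESCALING for the `G′`-families: `orbFamG`, `orbFamGExt` and the stable sums `stableSumG (orbFamGExt …)` are LINEAR in the Haar measure of `G′_∞` and in the test function,
# so an arbitrary Haar measure is the product-convention one up to a constant the test function absorbs (Folland 1995 §2.2, §2.6; Deitmar–Echterhoff 2014 Thm. 1.5.3; Rogawski 1990 §1.7)

Topic `NumberTheory/Rogawski1990`; namespace `Literature.NumberTheory.Rogawski1990`.  THEOREMS ONLY (no `def`, no instance, no notation, no axiom, no named fact, no `sorry`).
Cell `pub/hodgecm-mathlib`, crux H413 (`stmt-HodgeConjecture-24833`), line LH2 (closer stub `stub_N8`, organ (Sh)′), N8-INNER ROAD B «EP road» (dealer LH2-plan (g1)), brick (12′)∕E3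
«EP ASSEMBLY = H-S4′» (holder LH3-p04 (g7), CENSUS-E3 v1 4ea0a828 §1(d), §2(6), binder (B5)), sub-hand **§2(6) «HAAR RESCALING»** (dealer 17:08:00Z).  Author F0P3a-p04 (g27).  Count-neutral.

THE POINT.  E3's head quantifies over ARBITRARY Haar measures `ν′` on `U(diag α)(L⁺ ⊗ ℝ)` and `νβ` on `U(diag β₀)(L⁺ ⊗ ℝ)`, while every per-place tool ((F2), E2b, (J-iso), (IT)) is stated
under the PRODUCT convention `ν₀ = e⁻¹_* ⊗_w ν′_w`.  Haar uniqueness (Mathlib `isMulLeftInvariant_eq_smul`: `ν′ = haarScalarFactor ν′ ν₀ • ν₀`) and the linearity of the chart orbital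
functional in the measure (★ `chartOrbG_smul_measure`, LH3-p03 (g3)) make the two currencies differ by ONE positive constant, uniform in the label, the coordinate and the test function —
and linearity in the TEST FUNCTION (★ F4 `chartOrbG_classMul` with a constant class function) lets `f` absorb it.  This file lifts both linearities from `chartOrbG` to the three
families E3 reads.
* §1 MEASURE SIDE (`κ : ℝ≥0`, `κ ≠ 0`, `ν′` Haar and right invariant): `orbFamG_smul_measure` (every label ∕ coordinate), `orbFamGExt_smul_measure_of_mem_regG` (on ★ `RegG S′`, where the
  extended family IS the raw one, ★ `orbFamGExt_of_mem_regG`; off `RegG` the wall values are `extendFrom`-limits, not read by E3), `orbFamGExt_smul_measure_of_not_admissible` (junk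
  labels: `0 = 0`), **`stableSumG_orbFamGExt_smul_measure`** (`c ∈ RegG S′`; the partner points are regular, ★ `slotPerm_mem_regG_iff`), and the `haarScalarFactor` readings against a
  reference Haar `ν₀`: `orbFamGExt_eq_haarScalarFactor_mul_of_mem_regG`, **`stableSumG_orbFamGExt_eq_haarScalarFactor_mul`**, and the product-convention instance
  **`stableSumG_orbFamGExt_eq_haarScalarFactor_mul_prodConvention`** (`ν₀ := (Measure.pi ν′w).map e.symm`, ★ `isHaarMeasure_prodConventionG`).
* §2 TEST-FUNCTION SIDE (`z : ℂ`, ANY `ν′`): `chartOrbG_const_mul`, `orbFamG_const_mul`, `orbFamGExt_const_mul_of_mem_regG`, **`stableSumG_orbFamGExt_const_mul`** (`c ∈ RegG S′`, every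
  label — on a junk label both sides vanish), `ArchSmooth.const_mul` — all one-liners over ★ F4 with the constant class function `fun _ => z`.
* §3 ABSORPTION **`stableSumG_orbFamGExt_smul_measure_const_mul_inv`** (`κ ≠ 0`: `stableSumG (orbFamGExt L α (κ • ν′) (fun k => (κ : ℂ)⁻¹ * a′ k)) S′ c = stableSumG (orbFamGExt L α ν′ a′) S′ c`
  on `RegG S′`) and the packaged socket **`exists_archSmooth_stableSumG_orbFamGExt_smul_measure_eq`**: for `f ∈ C_c^∞(G′_∞)` and `κ ≠ 0` there is `f′ ∈ C_c^∞` with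
  `SS_{κ•ν}(f′) = SS_ν(f)` on every `RegG S′` — «`f` absorbs the constant».
HONEST LABEL: (Sh)′ ∕ row `stub_N8` stay PRINT-labelled until E3 and its binders are ★ and ED. 43 re-keys 27456; HC_CM is proved only modulo the 7 printed citations (2 remaining:
hLiu418 = stmt-HodgeConjecture-24832, h413 = stmt-HodgeConjecture-24833) until rung 0 closes; measure bookkeeping, pays nothing by itself.

## References
* [Folland1995] G. B. Folland, *A Course in Abstract Harmonic Analysis* (1995), §2.2 (uniqueness of Haar measure), §2.6 Thm. 2.49, (2.52).
* [DeitmarEchterhoff2014] A. Deitmar, S. Echterhoff, *Principles of Harmonic Analysis*, 2nd ed. (2014), Thm. 1.5.3.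
* [Rogawski1990] J. D. Rogawski, *Automorphic Representations of Unitary Groups in Three Variables*, Ann. of Math. Stud. 123 (1990), §1.7 p. 6 (measures), §4.1 (4.1.1) p. 39, §8.2 p. 122.
* [BorelJacquet1979] A. Borel, H. Jacquet, *Automorphic forms and automorphic representations*, PSPM 33.1 (1979), §4.1.
-/

set_option autoImplicit false

noncomputable section

open MeasureTheory MeasureTheory.Measure NumberField NumberField.InfinitePlace Complex Set Function
open Literature.NumberTheory.Automorphic Literature.NumberTheory.Automorphic.UnitaryGroup Literature.NumberTheory.Automorphic.ArchCartan
open Literature.MeasureTheory.Group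
open scoped Classical MatrixGroups Matrix NNReal ENNReal

namespace Literature.NumberTheory.Rogawski1990

/-! ## §1 Linearity in the Haar measure -/

section Measure

variable (L : Type) [Field L] [NumberField L] [IsCMField L] (α : Fin 3 → L)
  [MeasurableSpace ↥(arch (↥(maximalRealSubfield L)) L (IsCMField.complexConj L) 3 (Matrix.diagonal α))] [BorelSpace ↥(arch (↥(maximalRealSubfield L)) L (IsCMField.complexConj L) 3 (Matrix.diagonal α))]
  (ν' : Measure ↥(arch (↥(maximalRealSubfield L)) L (IsCMField.complexConj L) 3 (Matrix.diagonal α))) [ν'.IsHaarMeasure] [ν'.IsMulRightInvariant]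
  (a' : ↥(arch (↥(maximalRealSubfield L)) L (IsCMField.complexConj L) 3 (Matrix.diagonal α)) → ℂ)

/-- **`orbFamG` is linear in the Haar measure**: `orbFamG L α (κ • ν′) a′ S′ c = κ · orbFamG L α ν′ a′ S′ c` (every label and coordinate; ★ `chartOrbG_smul_measure` on an admissible
label, `0 = κ · 0` on a junk one). [cite: DeitmarEchterhoff2014, Thm. 1.5.3] [cite: Folland1995, §2.6 (2.52)] -/
theorem orbFamG_smul_measure {κ : ℝ≥0} (hκ : κ ≠ 0) (S' : Finset {w : InfinitePlace L // IsComplex w}) (c : {w : InfinitePlace L // IsComplex w} → Fin 3 → ℝ) :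
    orbFamG L α (κ • ν') a' S' c = (κ : ℂ) * orbFamG L α ν' a' S' c := by
  by_cases hS' : ∀ w, w ∈ S' → w ∈ splitChartPlaces L α
  · rw [orbFamG_apply L α (κ • ν') a' hS', orbFamG_apply L α ν' a' hS', chartOrbG_smul_measure L α S' ν' hκ a' c]
    ring
  · rw [orbFamG_of_not L α (κ • ν') a' hS', orbFamG_of_not L α ν' a' hS', mul_zero]

/-- **`orbFamGExt` is linear in the Haar measure on the `G`-regular set** (there it IS the raw family, ★ `orbFamGExt_of_mem_regG`). [cite: DeitmarEchterhoff2014, Thm. 1.5.3]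
[cite: Rogawski1990, §8.2 p. 122] -/
theorem orbFamGExt_smul_measure_of_mem_regG {κ : ℝ≥0} (hκ : κ ≠ 0) (S' : Finset {w : InfinitePlace L // IsComplex w}) {c : {w : InfinitePlace L // IsComplex w} → Fin 3 → ℝ}
    (hc : c ∈ RegG S') : orbFamGExt L α (κ • ν') a' S' c = (κ : ℂ) * orbFamGExt L α ν' a' S' c := by
  rw [orbFamGExt_of_mem_regG L α (κ • ν') a' S' hc, orbFamGExt_of_mem_regG L α ν' a' S' hc, orbFamG_smul_measure L α ν' a' hκ S' c]

omit [ν'.IsHaarMeasure] in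
/-- On a junk label both extended families vanish identically (★ `orbFamGExt_of_not_admissible`). [cite: Rogawski1990, §8.2 p. 122] -/
theorem orbFamGExt_smul_measure_of_not_admissible (κ : ℝ≥0) {S' : Finset {w : InfinitePlace L // IsComplex w}} (hS' : ¬ ∀ w, w ∈ S' → w ∈ splitChartPlaces L α)
    [IsFiniteMeasureOnCompacts ν'] :
    orbFamGExt L α (κ • ν') a' S' = fun c => (κ : ℂ) * orbFamGExt L α ν' a' S' c := by
  rw [orbFamGExt_of_not_admissible L α (κ • ν') a' S' hS', orbFamGExt_of_not_admissible L α ν' a' S' hS']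
  funext c
  rw [mul_zero]

/-- **THE STABLE SUM OF THE EXTENDED FAMILY IS LINEAR IN THE HAAR MEASURE** at a `G`-regular point: `stableSumG (orbFamGExt L α (κ • ν′) a′) S′ c = κ · stableSumG (orbFamGExt L α ν′ a′) S′ c`
(every partner point `slotPerm ρ c` is regular, ★ `slotPerm_mem_regG_iff`). [cite: DeitmarEchterhoff2014, Thm. 1.5.3] [cite: Rogawski1990, §4.1 (4.1.1) p. 39] -/
theorem stableSumG_orbFamGExt_smul_measure {κ : ℝ≥0} (hκ : κ ≠ 0) (S' : Finset {w : InfinitePlace L // IsComplex w}) {c : {w : InfinitePlace L // IsComplex w} → Fin 3 → ℝ}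
    (hc : c ∈ RegG S') : stableSumG (orbFamGExt L α (κ • ν') a') S' c = (κ : ℂ) * stableSumG (orbFamGExt L α ν' a') S' c := by
  rw [stableSumG_apply, stableSumG_apply, Finset.mul_sum]
  refine Finset.sum_congr rfl fun ρ hρ => ?_
  rw [orbFamGExt_smul_measure_of_mem_regG L α ν' a' hκ S' ((slotPerm_mem_regG_iff hρ c).2 hc)]
  ring

/-- **An ARBITRARY Haar measure against a reference one**: `orbFamGExt L α ν′ a′ S′ c = haarScalarFactor ν′ ν₀ · orbFamGExt L α ν₀ a′ S′ c` on `RegG S′` (Mathlib `isMulLeftInvariant_eq_smul`).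
[cite: Folland1995, §2.2] [cite: Rogawski1990, §1.7 p. 6] -/
theorem orbFamGExt_eq_haarScalarFactor_mul_of_mem_regG (ν₀ : Measure ↥(arch (↥(maximalRealSubfield L)) L (IsCMField.complexConj L) 3 (Matrix.diagonal α))) [ν₀.IsHaarMeasure] [ν₀.IsMulRightInvariant]
    (S' : Finset {w : InfinitePlace L // IsComplex w}) {c : {w : InfinitePlace L // IsComplex w} → Fin 3 → ℝ} (hc : c ∈ RegG S') :
    orbFamGExt L α ν' a' S' c = ((haarScalarFactor ν' ν₀ : ℝ) : ℂ) * orbFamGExt L α ν₀ a' S' c := by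
  by_cases hS' : ∀ w, w ∈ S' → w ∈ splitChartPlaces L α
  · rw [orbFamGExt_of_mem_regG_of_admissible L α ν' a' S' hS' hc, orbFamGExt_of_mem_regG_of_admissible L α ν₀ a' S' hS' hc, chartOrbG_eq_haarScalarFactor_mul L α S' ν' ν₀ a' c]
    ring
  · rw [orbFamGExt_of_not_admissible L α ν' a' S' hS', orbFamGExt_of_not_admissible L α ν₀ a' S' hS', mul_zero]

/-- **The stable sum against a reference Haar measure**: `stableSumG (orbFamGExt L α ν′ a′) S′ c = haarScalarFactor ν′ ν₀ · stableSumG (orbFamGExt L α ν₀ a′) S′ c` at a `G`-regular point.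
[cite: Folland1995, §2.2; §2.6 (2.52)] [cite: Rogawski1990, §4.1 (4.1.1) p. 39] -/
theorem stableSumG_orbFamGExt_eq_haarScalarFactor_mul (ν₀ : Measure ↥(arch (↥(maximalRealSubfield L)) L (IsCMField.complexConj L) 3 (Matrix.diagonal α))) [ν₀.IsHaarMeasure] [ν₀.IsMulRightInvariant]
    (S' : Finset {w : InfinitePlace L // IsComplex w}) {c : {w : InfinitePlace L // IsComplex w} → Fin 3 → ℝ} (hc : c ∈ RegG S') :
    stableSumG (orbFamGExt L α ν' a') S' c = ((haarScalarFactor ν' ν₀ : ℝ) : ℂ) * stableSumG (orbFamGExt L α ν₀ a') S' c := by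
  rw [stableSumG_apply, stableSumG_apply, Finset.mul_sum]
  refine Finset.sum_congr rfl fun ρ hρ => ?_
  rw [orbFamGExt_eq_haarScalarFactor_mul_of_mem_regG L α ν' a' ν₀ S' ((slotPerm_mem_regG_iff hρ c).2 hc)]
  ring

end Measure

/-! ## §1′ The product-measure convention as the reference -/

section Convention

variable (L : Type) [Field L] [NumberField L] [IsCMField L] (α : Fin 3 → L)
  [∀ w : {w : InfinitePlace L // IsComplex w}, MeasurableSpace ↥(archLocal L 3 (Matrix.diagonal α) w)]
  [∀ w : {w : InfinitePlace L // IsComplex w}, BorelSpace ↥(archLocal L 3 (Matrix.diagonal α) w)]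
  [MeasurableSpace ↥(arch (↥(maximalRealSubfield L)) L (IsCMField.complexConj L) 3 (Matrix.diagonal α))] [BorelSpace ↥(arch (↥(maximalRealSubfield L)) L (IsCMField.complexConj L) 3 (Matrix.diagonal α))]
  (ν'w : ∀ w : {w : InfinitePlace L // IsComplex w}, Measure ↥(archLocal L 3 (Matrix.diagonal α) w)) [∀ w, (ν'w w).IsHaarMeasure] [∀ w, (ν'w w).IsMulRightInvariant]
  (ν' : Measure ↥(arch (↥(maximalRealSubfield L)) L (IsCMField.complexConj L) 3 (Matrix.diagonal α))) [ν'.IsHaarMeasure] [ν'.IsMulRightInvariant]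
  (a' : ↥(arch (↥(maximalRealSubfield L)) L (IsCMField.complexConj L) 3 (Matrix.diagonal α)) → ℂ)

/-- **THE STABLE SUM FOR AN ARBITRARY HAAR MEASURE IS `haarScalarFactor ν′ ν₀` TIMES THE PRODUCT-CONVENTION ONE**, `ν₀ = e⁻¹_* ⊗_w ν′_w` (★ `isHaarMeasure_prodConventionG`,
★ `isMulRightInvariant_prodConventionG`), at every `G`-regular point of every label — the bridge from E3's head (any Haar `ν′`) to its per-place tools ((F2), E2b, (IT), (J-iso)).
[cite: Folland1995, §2.2; §2.6 (2.52)] [cite: BorelJacquet1979, §4.1] [cite: Rogawski1990, §1.7 p. 6] -/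
theorem stableSumG_orbFamGExt_eq_haarScalarFactor_mul_prodConvention (S' : Finset {w : InfinitePlace L // IsComplex w}) {c : {w : InfinitePlace L // IsComplex w} → Fin 3 → ℝ}
    (hc : c ∈ RegG S') :
    haveI := isHaarMeasure_prodConventionG L α ν'w
    haveI := isMulRightInvariant_prodConventionG L α ν'w
    stableSumG (orbFamGExt L α ν' a') S' c =
      ((haarScalarFactor ν' ((Measure.pi ν'w).map (archPiEquivCM 3 L (Matrix.diagonal α)).symm) : ℝ) : ℂ) *
        stableSumG (orbFamGExt L α ((Measure.pi ν'w).map (archPiEquivCM 3 L (Matrix.diagonal α)).symm) a') S' c := by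
  haveI := isHaarMeasure_prodConventionG L α ν'w
  haveI := isMulRightInvariant_prodConventionG L α ν'w
  exact stableSumG_orbFamGExt_eq_haarScalarFactor_mul L α ν' a' _ S' hc

end Convention

/-! ## §2 Linearity in the test function -/

section TestFunction

variable (L : Type) [Field L] [NumberField L] [IsCMField L] (α : Fin 3 → L)
  [MeasurableSpace ↥(arch (↥(maximalRealSubfield L)) L (IsCMField.complexConj L) 3 (Matrix.diagonal α))] [BorelSpace ↥(arch (↥(maximalRealSubfield L)) L (IsCMField.complexConj L) 3 (Matrix.diagonal α))]
  (ν' : Measure ↥(arch (↥(maximalRealSubfield L)) L (IsCMField.complexConj L) 3 (Matrix.diagonal α))) [IsFiniteMeasureOnCompacts ν'] [ν'.IsMulRightInvariant]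
  (a' : ↥(arch (↥(maximalRealSubfield L)) L (IsCMField.complexConj L) 3 (Matrix.diagonal α)) → ℂ) (z : ℂ)

/-- **`chartOrbG` is linear in the test function** (constant class function in ★ `chartOrbG_classMul`). [cite: Rogawski1990, §8.2 p. 122] -/
theorem chartOrbG_const_mul (S' : Finset {w : InfinitePlace L // IsComplex w}) (c : {w : InfinitePlace L // IsComplex w} → Fin 3 → ℝ) :
    chartOrbG L α ν' S' (fun k => z * a' k) c = z * chartOrbG L α ν' S' a' c :=
  chartOrbG_classMul L α ν' S' a' (fun _ => z) c

/-- `orbFamG` is linear in the test function (every label and coordinate). [cite: Rogawski1990, §8.2 p. 122] -/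
theorem orbFamG_const_mul (S' : Finset {w : InfinitePlace L // IsComplex w}) (c : {w : InfinitePlace L // IsComplex w} → Fin 3 → ℝ) :
    orbFamG L α ν' (fun k => z * a' k) S' c = z * orbFamG L α ν' a' S' c :=
  orbFamG_classMul L α ν' a' (fun _ => z) S' c

/-- `orbFamGExt` is linear in the test function on the `G`-regular set. [cite: Rogawski1990, §8.2 p. 122] -/
theorem orbFamGExt_const_mul_of_mem_regG (S' : Finset {w : InfinitePlace L // IsComplex w}) {c : {w : InfinitePlace L // IsComplex w} → Fin 3 → ℝ} (hc : c ∈ RegG S') :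
    orbFamGExt L α ν' (fun k => z * a' k) S' c = z * orbFamGExt L α ν' a' S' c :=
  orbFamGExt_classMul_of_mem_regG L α ν' a' (fun _ => z) S' hc

/-- **The stable sum is linear in the test function** at a `G`-regular point of EVERY label (on a junk label both sides are `0`; ★ `stableSumG_orbFamGExt_classMul_eq_ite` with a constant
class function). [cite: Rogawski1990, §4.1 (4.1.1) p. 39] -/
theorem stableSumG_orbFamGExt_const_mul (S' : Finset {w : InfinitePlace L // IsComplex w}) {c : {w : InfinitePlace L // IsComplex w} → Fin 3 → ℝ} (hc : c ∈ RegG S') :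
    stableSumG (orbFamGExt L α ν' (fun k => z * a' k)) S' c = z * stableSumG (orbFamGExt L α ν' a') S' c := by
  have h := stableSumG_orbFamGExt_classMul_eq_ite L α ν' a' (fun _ => z) S' hc
  by_cases hS' : ∀ w, w ∈ S' → w ∈ splitChartPlaces L α
  · simpa only [if_pos hS'] using h
  · rw [h, if_neg hS', zero_mul, stableSumG_apply]
    symm
    rw [mul_eq_zero]
    exact Or.inr (Finset.sum_eq_zero fun ρ _ => by rw [orbFamGExt_of_not_admissible L α ν' a' S' hS', mul_zero])

omit [MeasurableSpace ↥(arch (↥(maximalRealSubfield L)) L (IsCMField.complexConj L) 3 (Matrix.diagonal α))] [BorelSpace ↥(arch (↥(maximalRealSubfield L)) L (IsCMField.complexConj L) 3 (Matrix.diagonal α))]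
  [IsFiniteMeasureOnCompacts ν'] [ν'.IsMulRightInvariant] in
/-- `C_c^∞(G′_∞)` is stable under scalars (constant class function in ★ `ArchSmooth.classMul`). [cite: BorelJacquet1979, §4.1] -/
theorem ArchSmooth.const_mul {a' : ↥(arch (↥(maximalRealSubfield L)) L (IsCMField.complexConj L) 3 (Matrix.diagonal α)) → ℂ} (ha' : ArchSmooth L 3 (Matrix.diagonal α) a') (z : ℂ) :
    ArchSmooth L 3 (Matrix.diagonal α) (fun k => z * a' k) :=
  ha'.classMul L α (F := fun _ => z) contDiff_const

end TestFunction

/-! ## §3 Absorption: rescaling the measure is undone by rescaling the test function -/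

section Absorb

variable (L : Type) [Field L] [NumberField L] [IsCMField L] (α : Fin 3 → L)
  [MeasurableSpace ↥(arch (↥(maximalRealSubfield L)) L (IsCMField.complexConj L) 3 (Matrix.diagonal α))] [BorelSpace ↥(arch (↥(maximalRealSubfield L)) L (IsCMField.complexConj L) 3 (Matrix.diagonal α))]
  (ν' : Measure ↥(arch (↥(maximalRealSubfield L)) L (IsCMField.complexConj L) 3 (Matrix.diagonal α))) [ν'.IsHaarMeasure] [ν'.IsMulRightInvariant]
  (a' : ↥(arch (↥(maximalRealSubfield L)) L (IsCMField.complexConj L) 3 (Matrix.diagonal α)) → ℂ)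

/-- **ABSORPTION**: `stableSumG (orbFamGExt L α (κ • ν′) (κ⁻¹ · a′)) S′ c = stableSumG (orbFamGExt L α ν′ a′) S′ c` at a `G`-regular point (`κ ≠ 0`).
[cite: Folland1995, §2.6 (2.52)] [cite: Rogawski1990, §1.7 p. 6] -/
theorem stableSumG_orbFamGExt_smul_measure_const_mul_inv {κ : ℝ≥0} (hκ : κ ≠ 0) (S' : Finset {w : InfinitePlace L // IsComplex w})
    {c : {w : InfinitePlace L // IsComplex w} → Fin 3 → ℝ} (hc : c ∈ RegG S') :
    stableSumG (orbFamGExt L α (κ • ν') (fun k => ((κ : ℝ) : ℂ)⁻¹ * a' k)) S' c = stableSumG (orbFamGExt L α ν' a') S' c := by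
  rw [stableSumG_orbFamGExt_const_mul L α (κ • ν') a' _ S' hc, stableSumG_orbFamGExt_smul_measure L α ν' a' hκ S' hc, ← mul_assoc]
  have hκC : ((κ : ℝ) : ℂ) ≠ 0 := by exact_mod_cast hκ
  rw [inv_mul_cancel₀ hκC, one_mul]

/-- **«`f` ABSORBS THE CONSTANT» — the socket E3 calls once per side**: for `f ∈ C_c^∞(G′_∞)` and `κ ≠ 0` there is `f′ ∈ C_c^∞(G′_∞)` (namely `κ⁻¹ · f`) whose stable extended family for the
rescaled measure `κ • ν′` equals that of `f` for `ν′` at every `G`-regular point of every label. [cite: Folland1995, §2.2; §2.6 (2.52)] [cite: Rogawski1990, §1.7 p. 6; §4.1 (4.1.1) p. 39] -/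
theorem exists_archSmooth_stableSumG_orbFamGExt_smul_measure_eq {κ : ℝ≥0} (hκ : κ ≠ 0)
    {f : ↥(arch (↥(maximalRealSubfield L)) L (IsCMField.complexConj L) 3 (Matrix.diagonal α)) → ℂ} (hf : ArchSmooth L 3 (Matrix.diagonal α) f) :
    ∃ f' : ↥(arch (↥(maximalRealSubfield L)) L (IsCMField.complexConj L) 3 (Matrix.diagonal α)) → ℂ, ArchSmooth L 3 (Matrix.diagonal α) f' ∧
      ∀ (S' : Finset {w : InfinitePlace L // IsComplex w}) (c : {w : InfinitePlace L // IsComplex w} → Fin 3 → ℝ), c ∈ RegG S' →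
        stableSumG (orbFamGExt L α (κ • ν') f') S' c = stableSumG (orbFamGExt L α ν' f) S' c :=
  ⟨fun k => ((κ : ℝ) : ℂ)⁻¹ * f k, hf.const_mul L α _, fun S' _ hc => stableSumG_orbFamGExt_smul_measure_const_mul_inv L α ν' f hκ S' hc⟩

/-- **The same against a reference Haar measure `ν₀`**: there is `f′ ∈ C_c^∞` with `SS_{ν′}(f′) = SS_{ν₀}(f)` on every `RegG S′` (take `f′ := (haarScalarFactor ν′ ν₀)⁻¹ · f`).
[cite: Folland1995, §2.2] [cite: Rogawski1990, §1.7 p. 6] -/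
theorem exists_archSmooth_stableSumG_orbFamGExt_eq_of_isHaarMeasure
    (ν₀ : Measure ↥(arch (↥(maximalRealSubfield L)) L (IsCMField.complexConj L) 3 (Matrix.diagonal α))) [ν₀.IsHaarMeasure] [ν₀.IsMulRightInvariant]
    {f : ↥(arch (↥(maximalRealSubfield L)) L (IsCMField.complexConj L) 3 (Matrix.diagonal α)) → ℂ} (hf : ArchSmooth L 3 (Matrix.diagonal α) f) :
    ∃ f' : ↥(arch (↥(maximalRealSubfield L)) L (IsCMField.complexConj L) 3 (Matrix.diagonal α)) → ℂ, ArchSmooth L 3 (Matrix.diagonal α) f' ∧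
      ∀ (S' : Finset {w : InfinitePlace L // IsComplex w}) (c : {w : InfinitePlace L // IsComplex w} → Fin 3 → ℝ), c ∈ RegG S' →
        stableSumG (orbFamGExt L α ν' f') S' c = stableSumG (orbFamGExt L α ν₀ f) S' c := by
  have hκ : haarScalarFactor ν' ν₀ ≠ 0 := (haarScalarFactor_pos_of_isHaarMeasure ν' ν₀).ne'
  have hκC : ((haarScalarFactor ν' ν₀ : ℝ) : ℂ) ≠ 0 := by exact_mod_cast hκ
  refine ⟨fun k => ((haarScalarFactor ν' ν₀ : ℝ) : ℂ)⁻¹ * f k, hf.const_mul L α _, fun S' c hc => ?_⟩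
  rw [stableSumG_orbFamGExt_const_mul L α ν' f _ S' hc, stableSumG_orbFamGExt_eq_haarScalarFactor_mul L α ν' f ν₀ S' hc, ← mul_assoc, inv_mul_cancel₀ hκC, one_mul]

end Absorb

end Literature.NumberTheory.Rogawski1990

end
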